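import Mathlib
import Literature.Analysis.FluidPDE.ClassicalShortTimeSupBound
import Literature.Analysis.FluidPDE.AxisymmetricEuler
import Summits.NavierStokesRegularity.NavierStokesRegularity.Theorems.TypeIIInviscidRelaxationCoreExclusionAnchorReduction
import HarnessLib

/-!
# Cruxes `ColumnarCoreExclusion` (stmt-1966) / `MonopoleCoreExclusion` (stmt-1965): the shadowing stubs on the
# VISCOUS WINDOW — Leray's doubling time closes them there, with no comparison flow, and the window is empty
# before a blow-up time

`--supports stmt-NavierStokesRegularity-1966` (helper file; theorems only, no definitions, no `sorry`; class-free, so it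
serves verbatim the conclusions of BOTH registered shadowing stubs: `stub_columnarShadowing` of line
`columnar_comparison_flow` (1966, skeleton `812bbbce6ea9853a`) and `stub_axisymShadowing` of line
`axisymmetric_comparison_flow` (1965, skeleton `dd3458b3c2b350bd`)).

The two [XL] shadowing stubs conclude that a classical Leray–Hopf solution `u` on `[0,T)` with `sup ‖u(t,·)‖ ≤ V`
stays bounded on `[t,T) × B` (`B` a core ball) when the horizon is at most `K` core turnovers, `(T - t)·V ≤ K·L`, and
`u(t)` is `A·V/K`-close on a larger ball to a columnar / axisymmetric bounded classical comparison flow.  This file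
records the exact part of that statement which the tree's dynamics already proves, and certifies that this part is
disjoint from the regime in which the cruxes invoke the stubs:

* §1 `lintegral_sq_le_of_lerayHopf` — every slice of an unforced Leray–Hopf solution has `∫‖u(t)‖² ≤ 2E(u(0))`
  (energy inequality from `0`), in the extended form consumed by Leray's doubling theorem.
* §2 `norm_le_two_mul_of_viscous_window` — LERAY'S DOUBLING TIME read on `[0,T)`: with the universal constant `c₀`
  of `exists_norm_le_two_mul_of_finiteEnergy_from` (Leray 1934 §21 (3.15); Ożański–Pooley 2018 Lemma 6.23 (i)), a
  speed bound `V` at time `t` propagates as `2V` to every `s ∈ [t,T)` with `s - t < c₀ν/V²`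
  (`u` classical on `[0,T)`, Leray–Hopf from `u(0)`; closed sub-slabs `[0,(s+T)/2]`).
* §3 `norm_le_two_mul_on_Ico_of_viscous_window`, `shadowingConclusion_of_viscous_window` — hence on the VISCOUS
  WINDOW `(T - t)·V² ≤ c₀ν` the solution is bounded by `2V` on the whole of `[t,T) × ℝ³`, and in particular the
  conclusion `∃ M, ∀ s ∈ Ico t T, ∀ x ∈ B, ‖u s x‖ ≤ M` of both shadowing stubs holds for EVERY set `B`, every
  level `K`, with no comparison flow, no closeness and no Reynolds hypothesis.
* §4 `viscous_window_empty_of_isMaximalSmoothSolution`, `exists_viscousWindow_const` — conversely, for a MAXIMAL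
  smooth solution (blow-up at `T`) from a rapidly decaying datum, Leray's necessary rate
  (`CoreExclusionAnchor.exists_leray_const_of_speedBound`, i.e. `leray_blowup_rate_top_holds`) gives
  `c₁ν ≤ (T - t)·V²` for every speed bound `V` at every `t < T`; with `c⋆ = min c₀ c₁` both statements hold with one
  constant: the window `(T - t)V² < c⋆ν` is where shadowing is a theorem and is never visited by the witnesses of a
  blow-up solution.
* §5 `columnarShadowing_of_superviscous`, `axisymShadowing_of_superviscous` — the REGISTERED stubs therefore
  reduce, by kernel-checked case split, to their restrictions to SUPER-VISCOUS horizons `c⋆ν < (T - t)·V²`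
  (hypothesis lists verbatim otherwise): a prover of either stub may assume the horizon exceeds the viscous time.

HONEST FRAMING.  §2–§3 are Leray 1934 in the stubs' clothing; the content of the shadowing stubs lies entirely in the
super-viscous regime `c⋆ν < (T - t)V² ≤ K·L·V` (between the viscous time and `K` turnovers), where `C⁰`-closeness
`A·V/K` at core Reynolds number `≥ K` must control up to `K·(LV/ν)/c⋆` doubling times — the [XL] research statement
of both line cards, untouched here.  No stub is closed by name; nothing about Navier–Stokes regularity is claimed.
-/

noncomputable section

open Set Metric MeasureTheory Function Filter Topology
open Literature.Analysis Literature.Analysis.FluidPDE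
open scoped ENNReal

namespace Summit.NavierStokesRegularity.NavierStokesRegularity.Theorems

-- the problem directory repeats the summit name (`NavierStokesRegularity/NavierStokesRegularity`)
set_option linter.dupNamespace false

namespace CoreExclusionShadowing

/-! ### §1 Finite energy on closed sub-slabs -/

/-- An unforced Leray–Hopf solution (`ν ≥ 0`) has `∫ ‖u(t)‖² ≤ 2·E(u(0))` at EVERY time `t ∈ [0, T']`, `T' ≤ T`, in
the extended form consumed by `exists_norm_le_two_mul_of_finiteEnergy_from` (energy inequality from `s = 0`,
dissipation dropped; every slice is `L²`). [cite: Leray1934, (5.2)] -/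
theorem lintegral_sq_le_of_lerayHopf {ν T T' : ℝ} (hν : 0 ≤ ν)
    {u : ℝ → EuclideanSpace ℝ (Fin 3) → EuclideanSpace ℝ (Fin 3)}
    (hLH : IsLerayHopfOn T ν 0 (u 0) u) (hT' : T' ≤ T) :
    ∃ C : ℝ≥0∞, C < ⊤ ∧ ∀ t ∈ Icc 0 T', ∫⁻ x, ‖u t x‖ₑ ^ 2 ≤ C := by
  refine ⟨ENNReal.ofReal (2 * VectorCalculus.kineticEnergy (u 0)), ENNReal.ofReal_lt_top, ?_⟩
  intro t ht
  have htT : t ∈ Icc 0 T := ⟨ht.1, ht.2.trans hT'⟩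
  obtain ⟨G, -, hE⟩ := hLH.energy_ineq_zero
  have h := hE t htT
  simp only [Pi.zero_apply, inner_zero_left, integral_zero, intervalIntegral.integral_zero,
    add_zero] at h
  have hd : 0 ≤ ν * (∫⁻ τ in Ioo 0 t, ∫⁻ x, ENNReal.ofReal (frobeniusNormSq (G τ x))).toReal :=
    mul_nonneg hν ENNReal.toReal_nonneg
  have hkin : VectorCalculus.kineticEnergy (u t) ≤ VectorCalculus.kineticEnergy (u 0) := by
    linarith
  have heq : ∫⁻ x, ‖u t x‖ₑ ^ 2 = eEnergy (u t) := rfl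
  rw [heq, hLH.eEnergy_eq htT]
  exact ENNReal.ofReal_le_ofReal (by linarith)

/-! ### §2 Leray's doubling time on the half-open lifespan -/

/-- **Leray's doubling time, read on `[0, T)`** (Leray 1934 §21 (3.15); Ożański–Pooley 2018 Lemma 6.23 (i); the tree
theorem `exists_norm_le_two_mul_of_finiteEnergy_from` applied on the closed sub-slab `[0, (s+T)/2]`).  With Leray's
universal constant `c₀ > 0`: if `(u, p)` is a classical solution of unforced Navier–Stokes (`ν > 0`) on
`ℝ³ × [0, T)`, Leray–Hopf from `u(0)`, and `‖u(t, x)‖ ≤ V` for all `x` at some `t ∈ [0, T)` (`V > 0`), then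
`‖u(s, x)‖ ≤ 2V` for every `s ∈ [t, T)` with `s - t < c₀ν/V²` and every `x`. [cite: Leray1934, §21 (3.15) p. 226]
[cite: OzanskiPooley2018, Lemma 6.23 (i)] -/
theorem norm_le_two_mul_of_viscous_window :
    ∃ c₀ : ℝ, 0 < c₀ ∧ ∀ {ν T t V : ℝ}
      {u : ℝ → EuclideanSpace ℝ (Fin 3) → EuclideanSpace ℝ (Fin 3)}
      {p : ℝ → EuclideanSpace ℝ (Fin 3) → ℝ},
      0 < ν → 0 < T → IsClassicalNSSolutionOn (Ico 0 T) ν 0 u p → IsLerayHopfOn T ν 0 (u 0) u →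
      0 ≤ t → t < T → 0 < V → (∀ x, ‖u t x‖ ≤ V) →
      ∀ s ∈ Ico t T, s - t < c₀ * ν / V ^ 2 → ∀ x, ‖u s x‖ ≤ 2 * V := by
  obtain ⟨c₀, hc₀, h⟩ := exists_norm_le_two_mul_of_finiteEnergy_from
  refine ⟨c₀, hc₀, ?_⟩
  intro ν T t V u p hν hT hcl hLH ht htT hV hVbd s hs hsw x
  -- the closed slab `[0, T']`, `T' = (s + T)/2`
  set T' : ℝ := (s + T) / 2 with hT'_def
  have hsT' : s < T' := by rw [hT'_def]; linarith [hs.2]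
  have hT'T : T' < T := by rw [hT'_def]; linarith [hs.2]
  have htT' : t < T' := lt_of_le_of_lt hs.1 hsT'
  have hcl' : IsClassicalNSSolutionOn (Icc 0 T') ν 0 u p :=
    hcl.mono (Icc_subset_Ico_right hT'T) (uniqueDiffOn_Icc (by linarith))
  have hfe := lintegral_sq_le_of_lerayHopf hν.le hLH hT'T.le
  exact h hν ht htT' hcl' hfe hV hVbd s ⟨hs.1, hsT'.le⟩ hsw x

/-! ### §3 The shadowing conclusion on the viscous window -/

/-- **Bounded by `2V` up to `T` on the viscous window.**  With Leray's constant `c₀`: if, in the setting of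
`norm_le_two_mul_of_viscous_window`, the remaining horizon is at most one doubling time, `(T - t)·V² ≤ c₀ν`, then
`‖u(s, x)‖ ≤ 2V` on the whole of `[t, T) × ℝ³`. [cite: Leray1934, §21 (3.15) p. 226] -/
theorem norm_le_two_mul_on_Ico_of_viscous_window :
    ∃ c₀ : ℝ, 0 < c₀ ∧ ∀ {ν T t V : ℝ}
      {u : ℝ → EuclideanSpace ℝ (Fin 3) → EuclideanSpace ℝ (Fin 3)}
      {p : ℝ → EuclideanSpace ℝ (Fin 3) → ℝ},
      0 < ν → 0 < T → IsClassicalNSSolutionOn (Ico 0 T) ν 0 u p → IsLerayHopfOn T ν 0 (u 0) u →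
      0 ≤ t → t < T → 0 < V → (∀ x, ‖u t x‖ ≤ V) → (T - t) * V ^ 2 ≤ c₀ * ν →
      ∀ s ∈ Ico t T, ∀ x, ‖u s x‖ ≤ 2 * V := by
  obtain ⟨c₀, hc₀, h⟩ := norm_le_two_mul_of_viscous_window
  refine ⟨c₀, hc₀, ?_⟩
  intro ν T t V u p hν hT hcl hLH ht htT hV hVbd hwin s hs x
  have hV2 : 0 < V ^ 2 := by positivity
  have hTt : T - t ≤ c₀ * ν / V ^ 2 := by
    rw [le_div_iff₀ hV2]
    exact hwin
  have hsw : s - t < c₀ * ν / V ^ 2 := lt_of_lt_of_le (by linarith [hs.2]) hTt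
  exact h hν hT hcl hLH ht htT hV hVbd s hs hsw x

/-- **The conclusion of both shadowing stubs holds on the viscous window, for every set and with no comparison
flow.**  With Leray's constant `c₀`: a classical solution of unforced Navier–Stokes on `ℝ³ × [0,T)`, Leray–Hopf from
`u(0)`, with `‖u(t,·)‖ ≤ V` at a time `0 < t < T` and `(T - t)·V² ≤ c₀ν`, satisfies
`∃ M, ∀ s ∈ Ico t T, ∀ x ∈ B, ‖u s x‖ ≤ M` for every `B ⊆ ℝ³` — the registered conclusions of
`stub_columnarShadowing` (`B = ball x₀ (3KL/8)`) and `stub_axisymShadowing` (`B = ball x₀ (KL/2)`), at every level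
`K`, without the comparison flow `v`, the closeness `A·V/K`, the near-maximum or the Reynolds clause.
[cite: Leray1934, §21 (3.15) p. 226] -/
theorem shadowingConclusion_of_viscous_window :
    ∃ c₀ : ℝ, 0 < c₀ ∧ ∀ (ν T t V : ℝ)
      (u : ℝ → EuclideanSpace ℝ (Fin 3) → EuclideanSpace ℝ (Fin 3))
      (p : ℝ → EuclideanSpace ℝ (Fin 3) → ℝ) (B : Set (EuclideanSpace ℝ (Fin 3))),
      0 < ν → 0 < T → IsClassicalNSSolutionOn (Ico 0 T) ν 0 u p → IsLerayHopfOn T ν 0 (u 0) u →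
      0 < t → t < T → 0 < V → (∀ x, ‖u t x‖ ≤ V) → (T - t) * V ^ 2 ≤ c₀ * ν →
      ∃ M : ℝ, ∀ s ∈ Ico t T, ∀ x ∈ B, ‖u s x‖ ≤ M := by
  obtain ⟨c₀, hc₀, h⟩ := norm_le_two_mul_on_Ico_of_viscous_window
  refine ⟨c₀, hc₀, ?_⟩
  intro ν T t V u p B hν hT hcl hLH ht htT hV hVbd hwin
  exact ⟨2 * V, fun s hs x _ => h hν hT hcl hLH ht.le htT hV hVbd hwin s hs x⟩

/-! ### §4 The viscous window is empty before a blow-up time -/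

/-- **Leray's necessary rate, squared: the viscous window is never visited by a blow-up solution.**  For a maximal
smooth solution `(u, p)` of unforced Navier–Stokes on `ℝ³ × [0, T)` (`ν, T > 0`; no smooth extension past `T`),
Leray–Hopf from its rapidly decaying datum, there is `c₁ > 0` (Leray's rate constant squared) such that every speed
bound `V` at every time `t ∈ [0, T)` satisfies `c₁·ν ≤ (T - t)·V²` (from `c√ν/√(T - t) ≤ V`,
`CoreExclusionAnchor.exists_leray_const_of_speedBound`). [cite: Leray1934, §19 (3.8)–(3.9) p. 224] -/
theorem viscous_window_empty_of_isMaximalSmoothSolution {ν T : ℝ}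
    {u : ℝ → EuclideanSpace ℝ (Fin 3) → EuclideanSpace ℝ (Fin 3)} {p : ℝ → EuclideanSpace ℝ (Fin 3) → ℝ}
    (hν : 0 < ν) (hT : 0 < T) (hmax : IsMaximalSmoothSolution ν 0 u p T)
    (hLH : IsLerayHopfOn T ν 0 (u 0) u) (hdec : HasRapidSpatialDecay (u 0)) :
    ∃ c₁ : ℝ, 0 < c₁ ∧ ∀ t ∈ Ico 0 T, ∀ V : ℝ, (∀ x, ‖u t x‖ ≤ V) → c₁ * ν ≤ (T - t) * V ^ 2 := by
  obtain ⟨c, hc, hrate⟩ := CoreExclusionAnchor.exists_leray_const_of_speedBound hν hT hmax hLH hdec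
  refine ⟨c ^ 2, by positivity, fun t ht V hV => ?_⟩
  have hTt : 0 < T - t := sub_pos.2 ht.2
  have hs : 0 < Real.sqrt (T - t) := Real.sqrt_pos.2 hTt
  have h1 : c * Real.sqrt ν / Real.sqrt (T - t) ≤ V := hrate t ht V hV
  have h0 : 0 ≤ c * Real.sqrt ν / Real.sqrt (T - t) := by positivity
  -- square both sides: `c²ν/(T - t) ≤ V²`
  have h2 : (c * Real.sqrt ν / Real.sqrt (T - t)) ^ 2 ≤ V ^ 2 := pow_le_pow_left₀ h0 h1 2
  have h3 : (c * Real.sqrt ν / Real.sqrt (T - t)) ^ 2 = c ^ 2 * ν / (T - t) := by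
    rw [div_pow, mul_pow, Real.sq_sqrt hν.le, Real.sq_sqrt hTt.le]
  rw [h3, div_le_iff₀ hTt] at h2
  linarith [h2]

/-- **One constant for both readings.**  There is a universal `c⋆ > 0` such that (a) [Leray's doubling] every
classical solution of unforced Navier–Stokes on `ℝ³ × [0,T)`, Leray–Hopf from `u(0)`, with `‖u(t,·)‖ ≤ V` (`V > 0`,
`0 ≤ t < T`) and `(T - t)·V² ≤ c⋆ν` is bounded by `2V` on `[t,T) × ℝ³`; and (b) [Leray's rate] if moreover the
solution is MAXIMAL with lifespan `T` and its datum decays rapidly, then `c⋆ν ≤ (T - t)·V²` for every such speed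
bound: the open viscous window `(T - t)V² < c⋆ν`, on which (a) proves the shadowing conclusion, is empty for the
blow-up solutions to which the cruxes apply the shadowing stubs. [cite: Leray1934, §19 (3.9), §21 (3.15)] -/
theorem exists_viscousWindow_const :
    ∃ c : ℝ, 0 < c ∧
      (∀ {ν T t V : ℝ} {u : ℝ → EuclideanSpace ℝ (Fin 3) → EuclideanSpace ℝ (Fin 3)}
        {p : ℝ → EuclideanSpace ℝ (Fin 3) → ℝ},
        0 < ν → 0 < T → IsClassicalNSSolutionOn (Ico 0 T) ν 0 u p → IsLerayHopfOn T ν 0 (u 0) u →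
        0 ≤ t → t < T → 0 < V → (∀ x, ‖u t x‖ ≤ V) → (T - t) * V ^ 2 ≤ c * ν →
        ∀ s ∈ Ico t T, ∀ x, ‖u s x‖ ≤ 2 * V) ∧
      (∀ {ν T t V : ℝ} {u : ℝ → EuclideanSpace ℝ (Fin 3) → EuclideanSpace ℝ (Fin 3)}
        {p : ℝ → EuclideanSpace ℝ (Fin 3) → ℝ},
        0 < ν → 0 < T → IsMaximalSmoothSolution ν 0 u p T → IsLerayHopfOn T ν 0 (u 0) u →
        HasRapidSpatialDecay (u 0) → 0 ≤ t → t < T → (∀ x, ‖u t x‖ ≤ V) → c * ν ≤ (T - t) * V ^ 2) := by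
  obtain ⟨c₀, hc₀, hdbl⟩ := norm_le_two_mul_on_Ico_of_viscous_window
  obtain ⟨c, hc, hrate⟩ := leray_blowup_rate_top_holds
  refine ⟨min c₀ (c ^ 2), lt_min hc₀ (by positivity), ?_, ?_⟩
  · intro ν T t V u p hν hT hcl hLH ht htT hV hVbd hwin s hs x
    have hwin' : (T - t) * V ^ 2 ≤ c₀ * ν :=
      hwin.trans (mul_le_mul_of_nonneg_right (min_le_left _ _) hν.le)
    exact hdbl hν hT hcl hLH ht htT hV hVbd hwin' s hs x
  · intro ν T t V u p hν hT hmax hLH hdec ht htT hV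
    -- Leray's rate with ITS constant `c` (the same proof as `exists_leray_const_of_speedBound`, constant exposed)
    have hbdd : ∀ T' ∈ Ioo 0 T, eLpNorm (uncurry u) ⊤
        ((volume : Measure (ℝ × EuclideanSpace ℝ (Fin 3))).restrict (Icc 0 T' ×ˢ univ)) < ⊤ :=
      eLpNorm_uncurry_top_lt_top_of_tao2011 tao2011_hasBoundedSobolevNormsOn_holds hν hmax.1 hLH hdec
    have hr := hrate ν T hν hT u p hmax hLH hbdd t ⟨ht, htT⟩
    have hV0 : 0 ≤ V := (norm_nonneg _).trans (hV 0)
    have h2 : eLpNorm (u t) ⊤ volume ≤ ENNReal.ofReal V := by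
      rw [eLpNorm_exponent_top]
      exact eLpNormEssSup_le_of_ae_bound (Eventually.of_forall hV)
    have h1 : c * Real.sqrt ν / Real.sqrt (T - t) ≤ V :=
      (ENNReal.ofReal_le_ofReal_iff hV0).1 ((hr).trans h2)
    have hTt : 0 < T - t := sub_pos.2 htT
    have h0 : 0 ≤ c * Real.sqrt ν / Real.sqrt (T - t) := by positivity
    have h3 : (c * Real.sqrt ν / Real.sqrt (T - t)) ^ 2 ≤ V ^ 2 := pow_le_pow_left₀ h0 h1 2
    have h4 : (c * Real.sqrt ν / Real.sqrt (T - t)) ^ 2 = c ^ 2 * ν / (T - t) := by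
      rw [div_pow, mul_pow, Real.sq_sqrt hν.le, Real.sq_sqrt hTt.le]
    rw [h4, div_le_iff₀ hTt] at h3
    calc min c₀ (c ^ 2) * ν ≤ c ^ 2 * ν := mul_le_mul_of_nonneg_right (min_le_right _ _) hν.le
      _ ≤ (T - t) * V ^ 2 := by linarith [h3]

/-! ### §5 The registered stubs reduce to super-viscous horizons -/

/-- **`stub_columnarShadowing` reduces to super-viscous horizons.**  With the universal constant `c⋆` of
`exists_viscousWindow_const`: the registered stub `stub_columnarShadowing` of line `columnar_comparison_flow`
(crux `ColumnarCoreExclusion`, stmt-1966; statement copied verbatim as the conclusion) follows from its restriction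
to horizons LONGER than the viscous time, i.e. from the same statement with the extra hypothesis
`c⋆ν < (T - t)·V²` — the complementary case is Leray's doubling bound (§3), uniformly in `A`, `K`, `v`.  The content
of the stub is thus confined to `c⋆ν < (T - t)V² ≤ K·L·V`. [cite: Leray1934, §21 (3.15) p. 226] -/
theorem columnarShadowing_of_superviscous :
    ∃ c : ℝ, 0 < c ∧
     ((∀ A : ℝ, 0 < A → ∃ K₀ : ℝ, 1 ≤ K₀ ∧ ∀ K : ℝ, K₀ ≤ K →
      ∀ (ν T t : ℝ) (u : ℝ → EuclideanSpace ℝ (Fin 3) → EuclideanSpace ℝ (Fin 3))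
        (p : ℝ → EuclideanSpace ℝ (Fin 3) → ℝ),
        0 < ν → 0 < T → IsClassicalNSSolutionOn (Ico 0 T) ν 0 u p → IsLerayHopfOn T ν 0 (u 0) u →
        HasRapidSpatialDecay (u 0) → 0 < t → t < T →
        ∀ (x₀ : EuclideanSpace ℝ (Fin 3)) (L V : ℝ)
          (Q : EuclideanSpace ℝ (Fin 3) ≃ₗᵢ[ℝ] EuclideanSpace ℝ (Fin 3)),
          0 < L → 0 < V → (∀ x, ‖u t x‖ ≤ V) →
          (∃ x₁, dist x₁ x₀ ≤ L ∧ V ≤ 2 * ‖u t x₁‖) → K * ν ≤ L * V → (T - t) * V ≤ K * L →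
          c * ν < (T - t) * V ^ 2 →
          ∀ (v : ℝ → EuclideanSpace ℝ (Fin 3) → EuclideanSpace ℝ (Fin 3))
            (q : ℝ → EuclideanSpace ℝ (Fin 3) → ℝ) (Mv : ℝ),
            IsClassicalNSSolutionOn (Icc t T) ν 0 v q →
            (∀ s ∈ Icc t T, ∀ (x : EuclideanSpace ℝ (Fin 3)) (τ : ℝ), v s (x + τ • Q eZ) = v s x) →
            (∀ s ∈ Icc t T, ∀ x, ‖v s x‖ ≤ Mv) →
            (∀ x ∈ ball x₀ (K * L / 2), ‖u t x - v t x‖ ≤ A * V / K) →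
            ∃ M : ℝ, ∀ s ∈ Ico t T, ∀ x ∈ ball x₀ (3 * K * L / 8), ‖u s x‖ ≤ M) →
     (∀ A : ℝ, 0 < A → ∃ K₀ : ℝ, 1 ≤ K₀ ∧ ∀ K : ℝ, K₀ ≤ K →
      ∀ (ν T t : ℝ) (u : ℝ → EuclideanSpace ℝ (Fin 3) → EuclideanSpace ℝ (Fin 3))
        (p : ℝ → EuclideanSpace ℝ (Fin 3) → ℝ),
        0 < ν → 0 < T → IsClassicalNSSolutionOn (Ico 0 T) ν 0 u p → IsLerayHopfOn T ν 0 (u 0) u →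
        HasRapidSpatialDecay (u 0) → 0 < t → t < T →
        ∀ (x₀ : EuclideanSpace ℝ (Fin 3)) (L V : ℝ)
          (Q : EuclideanSpace ℝ (Fin 3) ≃ₗᵢ[ℝ] EuclideanSpace ℝ (Fin 3)),
          0 < L → 0 < V → (∀ x, ‖u t x‖ ≤ V) →
          (∃ x₁, dist x₁ x₀ ≤ L ∧ V ≤ 2 * ‖u t x₁‖) → K * ν ≤ L * V → (T - t) * V ≤ K * L →
          ∀ (v : ℝ → EuclideanSpace ℝ (Fin 3) → EuclideanSpace ℝ (Fin 3))
            (q : ℝ → EuclideanSpace ℝ (Fin 3) → ℝ) (Mv : ℝ),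
            IsClassicalNSSolutionOn (Icc t T) ν 0 v q →
            (∀ s ∈ Icc t T, ∀ (x : EuclideanSpace ℝ (Fin 3)) (τ : ℝ), v s (x + τ • Q eZ) = v s x) →
            (∀ s ∈ Icc t T, ∀ x, ‖v s x‖ ≤ Mv) →
            (∀ x ∈ ball x₀ (K * L / 2), ‖u t x - v t x‖ ≤ A * V / K) →
            ∃ M : ℝ, ∀ s ∈ Ico t T, ∀ x ∈ ball x₀ (3 * K * L / 8), ‖u s x‖ ≤ M)) := by
  obtain ⟨c, hc, hdbl, -⟩ := exists_viscousWindow_const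
  refine ⟨c, hc, fun hS A hA => ?_⟩
  obtain ⟨K₀, hK₀, hK⟩ := hS A hA
  refine ⟨K₀, hK₀, ?_⟩
  intro K hKK ν T t u p hν hT hcl hLH hdec ht htT x₀ L V Q hL hV hbd hnear hRe hlate v q Mv hv hvcol hvbd
    hclose
  by_cases hwin : (T - t) * V ^ 2 ≤ c * ν
  · exact ⟨2 * V, fun s hs x _ => hdbl hν hT hcl hLH ht.le htT hV hbd hwin s hs x⟩
  · exact hK K hKK ν T t u p hν hT hcl hLH hdec ht htT x₀ L V Q hL hV hbd hnear hRe hlate (lt_of_not_ge hwin)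
      v q Mv hv hvcol hvbd hclose

/-- **`stub_axisymShadowing` reduces to super-viscous horizons.**  With the universal constant `c⋆` of
`exists_viscousWindow_const`: the registered stub `stub_axisymShadowing` of line `axisymmetric_comparison_flow`
(crux `MonopoleCoreExclusion`, stmt-1965; statement copied verbatim as the conclusion) follows from its restriction
to horizons `c⋆ν < (T - t)·V²`; the complementary case is Leray's doubling bound (§3).
[cite: Leray1934, §21 (3.15) p. 226] -/
theorem axisymShadowing_of_superviscous :
    ∃ c : ℝ, 0 < c ∧
     ((∀ A : ℝ, 0 < A → ∃ K₀ : ℝ, 1 ≤ K₀ ∧ ∀ K : ℝ, K₀ ≤ K →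
      ∀ (ν T t : ℝ) (u : ℝ → EuclideanSpace ℝ (Fin 3) → EuclideanSpace ℝ (Fin 3))
        (p : ℝ → EuclideanSpace ℝ (Fin 3) → ℝ),
        0 < ν → 0 < T → IsClassicalNSSolutionOn (Ico 0 T) ν 0 u p → IsLerayHopfOn T ν 0 (u 0) u →
        HasRapidSpatialDecay (u 0) → 0 < t → t < T →
        ∀ (x₀ : EuclideanSpace ℝ (Fin 3)) (L V : ℝ)
          (Q : EuclideanSpace ℝ (Fin 3) ≃ₗᵢ[ℝ] EuclideanSpace ℝ (Fin 3)),
          0 < L → 0 < V → (∀ x, ‖u t x‖ ≤ V) →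
          (∃ x₁, dist x₁ x₀ ≤ L ∧ V ≤ 2 * ‖u t x₁‖) → K * ν ≤ L * V → (T - t) * V ≤ K * L →
          c * ν < (T - t) * V ^ 2 →
          ∀ (v : ℝ → EuclideanSpace ℝ (Fin 3) → EuclideanSpace ℝ (Fin 3))
            (q : ℝ → EuclideanSpace ℝ (Fin 3) → ℝ) (Mv : ℝ),
            IsClassicalNSSolutionOn (Icc t T) ν 0 v q →
            (∀ s ∈ Icc t T, IsAxisymmetric (fun y : EuclideanSpace ℝ (Fin 3) => Q.symm (v s (x₀ + Q y)))) →
            (∀ s ∈ Icc t T, ∀ x, ‖v s x‖ ≤ Mv) →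
            (∀ x ∈ ball x₀ (K * L), ‖u t x - v t x‖ ≤ A * V / K) →
            ∃ M : ℝ, ∀ s ∈ Ico t T, ∀ x ∈ ball x₀ (K * L / 2), ‖u s x‖ ≤ M) →
     (∀ A : ℝ, 0 < A → ∃ K₀ : ℝ, 1 ≤ K₀ ∧ ∀ K : ℝ, K₀ ≤ K →
      ∀ (ν T t : ℝ) (u : ℝ → EuclideanSpace ℝ (Fin 3) → EuclideanSpace ℝ (Fin 3))
        (p : ℝ → EuclideanSpace ℝ (Fin 3) → ℝ),
        0 < ν → 0 < T → IsClassicalNSSolutionOn (Ico 0 T) ν 0 u p → IsLerayHopfOn T ν 0 (u 0) u →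
        HasRapidSpatialDecay (u 0) → 0 < t → t < T →
        ∀ (x₀ : EuclideanSpace ℝ (Fin 3)) (L V : ℝ)
          (Q : EuclideanSpace ℝ (Fin 3) ≃ₗᵢ[ℝ] EuclideanSpace ℝ (Fin 3)),
          0 < L → 0 < V → (∀ x, ‖u t x‖ ≤ V) →
          (∃ x₁, dist x₁ x₀ ≤ L ∧ V ≤ 2 * ‖u t x₁‖) → K * ν ≤ L * V → (T - t) * V ≤ K * L →
          ∀ (v : ℝ → EuclideanSpace ℝ (Fin 3) → EuclideanSpace ℝ (Fin 3))
            (q : ℝ → EuclideanSpace ℝ (Fin 3) → ℝ) (Mv : ℝ),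
            IsClassicalNSSolutionOn (Icc t T) ν 0 v q →
            (∀ s ∈ Icc t T, IsAxisymmetric (fun y : EuclideanSpace ℝ (Fin 3) => Q.symm (v s (x₀ + Q y)))) →
            (∀ s ∈ Icc t T, ∀ x, ‖v s x‖ ≤ Mv) →
            (∀ x ∈ ball x₀ (K * L), ‖u t x - v t x‖ ≤ A * V / K) →
            ∃ M : ℝ, ∀ s ∈ Ico t T, ∀ x ∈ ball x₀ (K * L / 2), ‖u s x‖ ≤ M)) := by
  obtain ⟨c, hc, hdbl, -⟩ := exists_viscousWindow_const
  refine ⟨c, hc, fun hS A hA => ?_⟩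
  obtain ⟨K₀, hK₀, hK⟩ := hS A hA
  refine ⟨K₀, hK₀, ?_⟩
  intro K hKK ν T t u p hν hT hcl hLH hdec ht htT x₀ L V Q hL hV hbd hnear hRe hlate v q Mv hv hvax hvbd
    hclose
  by_cases hwin : (T - t) * V ^ 2 ≤ c * ν
  · exact ⟨2 * V, fun s hs x _ => hdbl hν hT hcl hLH ht.le htT hV hbd hwin s hs x⟩
  · exact hK K hKK ν T t u p hν hT hcl hLH hdec ht htT x₀ L V Q hL hV hbd hnear hRe hlate (lt_of_not_ge hwin)
      v q Mv hv hvax hvbd hclose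

end CoreExclusionShadowing

end Summit.NavierStokesRegularity.NavierStokesRegularity.Theorems

end
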